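import Mathlib
import Summits.QuantumFields.YangMills.Theses.UniversalDetector
import Summits.QuantumFields.YangMills.Theorems.UniversalDetectorHankelTightPath

/-!
# `UniversalDetector.HankelTightGlue` (item stmt-QuantumFields-24002) — proof

Glue of LINE g10-1 «Hankel tightness» (planner ym-idea-8) on route UniversalDetector (YangMills):
`SchemeEdgeLaws → HankelCeiling → HankelLongitudinal → PlaneTightScheme`.

Take `(r, a)`, EDGE, TRANS and NONCONTACT from `SchemeEdgeLaws`; `HankelCeiling` turns EDGE into
TIGHT6-boundedness (used at `η/2`), `HankelLongitudinal` turns boundedness into the longitudinal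
Lipschitz modulus outside every slab; the modulus of continuity of TIGHT6 for the pair `(p, q)` at
`η` is the four-leg axis walk of
`UniversalDetectorHankelTight.tight_of_bound_long_trans` (helper file
`UniversalDetectorHankelTightPath.lean`): `ω(δ) = 4(Λ⁺δ + ω_T⁺(δ))` for
`δ ≤ δ₀ = min(η/2, τ/2)`, `2C` beyond. NONCONTACT is carried verbatim.

Glue only: the crux `SchemeEdgeLaws` (23999) and the spine are untouched; no rung and no summit is
proved; the Yang–Mills mass gap is NOT proved by this.
-/

noncomputable section

namespace Summit.QuantumFields.YangMills.Theorems

open UniversalDetectorHankelTight in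
/-- **Item stmt-QuantumFields-24002 (`UniversalDetector.HankelTightGlue`).**
`SchemeEdgeLaws → HankelCeiling → HankelLongitudinal → PlaneTightScheme`: `(r, a)`, EDGE, TRANS
and NONCONTACT from `SchemeEdgeLaws`; boundedness from `HankelCeiling`; the longitudinal modulus
from `HankelLongitudinal`; TIGHT6's modulus by the four-leg axis walk of
`tight_of_bound_long_trans`. Glue only; no crux, rung or summit is proved. -/
theorem hankelTightGlue_proof :
    Summit.QuantumFields.YangMills.Theses.UniversalDetector.HankelTightGlue := by
  unfold Summit.QuantumFields.YangMills.Theses.UniversalDetector.HankelTightGlue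
  intro hS hC hL
  unfold Summit.QuantumFields.YangMills.Theses.UniversalDetector.PlaneTightScheme
  intro G _ _ _ _ hG
  obtain ⟨r, a, ha, ha0, hEDGE, hTRANS, hNC⟩ := hS G hG
  refine ⟨r, a, ha, ha0, ?_, hNC⟩
  intro p q hp hq η hη
  have hB := hC G r a ha ha0 hEDGE
  have hLo := hL G r a ha ha0 hB
  exact tight_of_bound_long_trans a ha _ hη (hB p q hp hq (η / 2) (by positivity))
    (hTRANS p q hp hq (η / 2) (by positivity))
    (fun τ hτ => hLo p q hp hq (η / 2) (by positivity) τ hτ)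

end Summit.QuantumFields.YangMills.Theorems

end
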